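import Literature.MathematicalPhysics.QuantumFieldTheory.Balaban1983to89.T4HypergraphFormat
import Literature.MathematicalPhysics.QuantumFieldTheory.Balaban1983to89.T4TermFormat

/-!
# `Balaban1983to89.T4MixedOscShape` — row T4-O3.E-ii.K3 of the uniqueness spine: the s-BODY sensitivity shape of the
iterated-averaged loop observable TYPED as a hypothesis (`LoopMixedOscBound`, stated over row K2's many-body parts
`T4HypergraphFormat.boolDelta (familyEval …)`), its locality, its reduction to NE1a and its identification with NE1a /
NE1 (ii) at s = 1, 2; the CONSUMER DECISION of the cell record as arithmetic (s-hyperedges at the first-order rate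
θ₁ = L⁻³ are K-uniform iff s ≤ 4); and the (α′) bookkeeping — a FAMILY of dressed components is ONE component for the
pair shape, and bilinear pair strengths feed `T4TermFormat.Booking.MayerSmall` through one weighted alive mass (cell
`pub-balaban`, T4-DAG v4 §5 row T4-O3.E-ii.K3°; kernel bookkeeping over `T4AvgSensitivity` / `T4JointDressing` /
`T4HypergraphFormat` / `T4TermFormat`, `Setup` vocabulary)

HONEST FRAMING (cell `pub-balaban`, T4-DAG PAGE 1).  The cell's T4 target is the existence AND uniqueness of the continuum
limit of Bałaban's unit-scale averaged loop expectations on a finite torus — a constructive-QFT statement strictly beyond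
ultraviolet stability ([Balaban1989LargeFieldII] Thm 1 p. 355); it is NOT the Yang–Mills mass gap and NOT the Clay
problem.  This module is the kernel item K3 deferred by the paper-level record `t4/T4-EST-O3Eii.md` (§2 (K3), §3.3 (b),
§3.4 (ii), located consequence G-pv18g3-1 (c)) of the SAME lineage that wrote `T4JointDressing`; it is built on the landed
item K2 (`T4HypergraphFormat`, another unit: the many-body parts `boolDelta`, the family evaluation `familyEval`, Möbius
inversion and the «+1 −1» format), whose free input — a bound `δ_T` on the `|T|`-body part of the exponent — is exactly
what the shape below supplies as a HYPOTHESIS.  It asserts NOTHING about Bałaban's operations or averagings: the s-body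
sensitivity of the cell's NEW estimate NE1 enters only as the HYPOTHESIS SHAPE `LoopMixedOscBound` (§2, NOT PRINTED — no
s-body, indeed no first-order, sensitivity statement for the averaging operations exists in the series;
[Balaban1985Averaging] Props 1–3 are regularity statements), and every theorem below is finite alternating-sum algebra,
the tree's locality lemma `T4AvgSensitivity.loopAt_iterFrom_eq_of_avoids`, elementary real arithmetic, or one `Finset` sum
estimate over the abstract ledger `T4TermFormat.Booking`.  Value = typed shape + kernel bookkeeping (exactly what an s-body
input would have to look like, that it is a conservative extension of the typed s = 1, 2 shapes, that it carries NO
information beyond NE1a unless its rate beats `θ`, and the arithmetic behind the record's decision NOT to consume it for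
s ≥ 5); NOT summit progress, NOT the cell's estimate NE1, NOT a proof of any sensitivity bound.

CITATION HEADER (lean-in-tree rule 2026-08-18).  This module QUOTES NOTHING NEW from the manuscripts under audit and uses no
disputed step of them.  Its objects are those of `T4AvgSensitivity` (iterated averaging `iterFrom`, influence sets `infl`,
the loop variable `loopAt · (walk x w)`, the first-order shape `LoopOscBound`) and `T4JointDressing` (the pair shape
`LoopPairOscBound`), whose citation headers carry the verbatim quotations this seat's lineage read on the renders: T. Bałaban,
*Averaging operations for lattice gauge theories*, Commun. Math. Phys. **98** (1985) 17–51 [Balaban1985Averaging], render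
`b2b-balaban-ref1/pages/1985-cmp98-averaging/1985-cmp98-averaging-p003-x2.png`, p. 19: (11) "(Ū^u)(y, y′) =
u(y)Ū(y, y′)u⁻¹(y′), or Ū^u = (Ū)^u." (gauge covariance) and (15) (the average `Ū_c` depends on `U` through the block
`B(c₋)` and the contours `Γ_{c,x}` only — the tree axiom `Setup.Averaging.local_dep`, the ONLY property of the averagings
used below, through `loopAt_iterFrom_eq_of_avoids`); and T. Bałaban, *Large field renormalization. I. The basic step of the
ℝ operation*, Commun. Math. Phys. **122** (1989) 175–202 [Balaban1989LargeFieldI], p. 201, the product structure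
"∏_{i=1}^{n} [ (1/Nᵢ) Σ … ∫dV′⌈_{Λᵢ} … ]" of (1.100) over the components `Λᵢ` of one term (quoted in `T4JointDressing`'s
header; it is the reason a dressed term has SEVERAL components to couple).  The many-body algebra is `T4HypergraphFormat`'s
(its header cites Rota 1964 Prop. 2 and Friedli–Velenik (6.122) as FORMAT templates).  The abstract ledger `Booking` of §4
is `T4TermFormat`'s (its header quotes [Balaban1988RG2Cluster] (1.18), (2.13), (2.20) for the SHAPE of sizes and
currencies; nothing of it is used here beyond the field `pair` and the predicate `MayerSmall`, both cell analysis, NOT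
PRINTED).

THE ROW (T4-DAG v4 §5, `t4/T4-DAG.md` sha256 72d96d27eb70a273…, verbatim): "T4-O3.E-ii.K3° | O3b | TYPE+PROVE | (v4)
pv18-g3's free item K3 + G-pv18g3-1 (c): the s-BODY shape `LoopMixedOscBound` (s-fold mixed differences ≤ C_s·Π θ-factors
with the separation law) and its CONSUMER DECISION — hyperedges are summable per fine bond only for s ≤ 4 at θ₁ = L^{−3}
(count L^{4(s−1)} vs rate θ₁^{s}) ⇒ type the block coupling of ≥ 2 dressed loops as ONE remainder term (α′: a single
`Booking` entry with pair = the family) or as a moment-type bound (β′), and prove the (α′) bookkeeping lemma feeding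
`T4TermFormat.Booking.pair` | `T4JointDressing` v2, `T4TermFormat` v1.1, `T4TubeBudget` | — | S/M |  | open".
The record text it serves (`t4/T4-EST-O3Eii.md` v1.4, verbatim): §3.3 (b) "Write y_S for the fibre coordinates of the
components in S ⊆ {1,…,p} and Δ_S F(y_S) := Σ_{T⊆S}(−1)^{|S|−|T|}F(V←y_T) (Δ_∅F = F(V); Δ_{i}F = F(V←yᵢ) − F(V); Δ_{ii′}F =
the mixed second difference of §1.2)" and "INPUTS: ‖Δ_SF‖ for |S| = s ≥ 2 — for s = 2 this is §1.2; for s ≥ 3 an s-body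
shape C_s|w|∏_{i∈S}|Λᵢ|·θ_s^{K−k} (K3 of §2; heuristic target θ_s = θ₁^s …)"; §3.4 (ii) "with the heuristic θ_s = θ₁^s
(§0 (e) F1) its (K − k)-dependence is (L^{4(s−1)}θ₁^s)^{K−k}, K-uniform iff θ₁ ≤ L^{−4(s−1)/s}: s = 2 ⇒ L^{−2}; s = 3 ⇒
L^{−8/3}; s = 4 ⇒ L^{−3}; s → ∞ ⇒ L^{−4}. … with θ₁ = L^{−3} (the DAG's «O(L^{−3}) per level») hyperedges of order
s ≤ 4 are summable and s ≥ 5 are not; with θ₁ = L^{−2} (T4-EST-O3c §3.1, curvature units) only pairs, at equality" and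
"the birth-step bookkeeping must either (α′) stop at (a) — total block coupling as ONE remainder per block, no distribution
into hyperedges …, or (β′) use MOMENT-type strengths per T4-REF-O3 V5 (i)–(iii)".

DICTIONARY.  A FAMILY of components of one term = `Λ : κ → Finset (PBond P k)` restricted to a finite index set
`T : Finset κ`, pairwise disjoint on `T`; the record's corner configuration `V←y_U` (the fibre coordinates of the members
`a ∈ U` switched on, the rest of the configuration kept) = `corner Λ V Y U := Function.updateFinset V (U.biUnion Λ) (Y⌈·)`
(§1: `Y` on `⋃_{a∈U} Λ a`, `V` elsewhere — with pairwise disjoint members every cube of configurations with the agreement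
law is of this form, `Y` = its top corner), so that row K2's `familyEval F Λ V Y U = F (corner Λ V Y U)` definitionally
(`familyEval_eq_corner`); the record's `Δ_S F` = K2's `boolDelta (familyEval F Λ V Y) S`; the s-body strength
`C_s|w|∏|Λᵢ|θ_sⁿ` = the right side of `LoopMixedOscBound av dom C θ` at `s = T.card` (§2); the record's per-level hyperedge
ratio `L^{4(s−1)}θ₁^s` = `hyperedgeRatio L θ₁ s` (§3); the (α′) entry "pair = the family" = `LoopPairOscBound.biUnion` (§4:
the pair shape evaluated on the UNIONS of two families, sizes adding) and its ledger reading `Booking.mayerSmall_of_bilinear`.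

CONTENTS.  §1 `corner` (pointwise evaluation, bottom corner, agreement off one member, peeling one member as a fibre update
`corner_insert`, the one- and two-member corners) and the triangle bound `abs_boolDelta_insert_le` for K2's `boolDelta`
(`2^{|T|}` first differences in one member).  §2 the SHAPE `LoopMixedOscBound` [NOT PRINTED, hypothesis only]; LOCALITY
`boolDelta_loop_eq_zero_of_avoids` (if the loop avoids the influence tube of ONE member the s-fold difference vanishes —
hyperedge activities live on families ALL of whose members influence the loop); REDUCTION `loopMixedOscBound_of_loopOscBound`
(NE1a `LoopOscBound av dom C_W θ` ⇒ the shape with `(2^{s−1}C_W, θ)` — no gain in the rate: the shape's only content is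
`θ_s < θ`), the trivial instance `(2^s, 1)`, and the IDENTIFICATIONS `loopOscBound_of_loopMixedOscBound` (s = 1 ⇒ NE1a with
`(C 1, θ 1)`), `loopPairOscBound_of_loopMixedOscBound` (s = 2 ⇒ NE1 (ii) with `(C 2, θ 2)`): the new shape is a conservative
extension of the two typed ones.  §3 the DECISION as elementary real arithmetic: `hyperedgeRatio L (L³)⁻¹ s = L^{s−4}`,
`≤ 1 ↔ s ≤ 4`, `> 1 ↔ 5 ≤ s`, bounded powers for `s ≤ 4`, unbounded for `s ≥ 5`, and the pair borderline
`hyperedgeRatio L (L²)⁻¹ 2 = 1`.  §4 (α′): `LoopPairOscBound.biUnion` and `Booking.mayerSmall_of_bilinear` (pair strengths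
`|pair b b′ k| ≤ c k·m b·m b′` are Mayer-small as soon as ONE weighted alive mass `Σ_{b′} m b′·u b′ ≤ M` and `c k·m b·M ≤ ε`
— the single count the record's §3.4 (ii) `α_block` performs).  §5 non-vacuity.

WHAT THIS DOES NOT DO.  It proves no sensitivity bound (every rate below is a hypothesis or the trivial `1`); it does not
type the separation law for s ≥ 3 bodies (the record has it only as a heuristic "one commutator per additional partner";
the typed separated shape is the s = 2 one, `T4JointDressing.LoopPairOscBoundSep`, and a uniform-rate s-body shape is what
§3.4 (ii)'s count consumes); it re-proves nothing of row K2 (Möbius inversion, the «+1 −1» expansion and its activity bounds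
are IMPORTED: with `|Δ_T| ≤ δ_T` supplied by `LoopMixedOscBound`, `T4HypergraphFormat.abs_prod_exp_mul_boolDelta_sub_one_le`
bounds every hyperedge monomial); it does not touch (β′) (moment-type strengths, T4-REF-O3 V5 — the located requirement
across scales, nobody's kernel item); and the `Booking` lemma of §4 is ledger algebra, not an estimate of any pair strength.

Located items NOT touched (no overlap): `T4JointDressing` / `T4JointDressingMany` (two-body and p-body Mayer steps, rows
T4-O3.E-ii / K1), `T4HypergraphFormat` (K2: imported, nothing restated), `T4TermFormat` / `T4GatedBooking` /
`T4PreservedUnderR` (the booking and its propagation, rows O3.E-iii-a, O3.E-iii-b-K*, O3.E-iii-c), `T4AvgSensitivity` /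
`T4AvgDerivBound` (NE1a and its derivative form, rows O3c / O3c.E2).  Every theorem is [folklore] (finite sums, locality
bookkeeping, elementary real arithmetic); the one definition tagged with a cite key, `LoopMixedOscBound`, is tagged for the LOCUS of the
averaging operation whose sensitivities it hypothesises, exactly as its s = 1, 2 predecessors, and is NOT PRINTED.

Versions: v1 (this file) — unit `b2b-balaban-pv18-g4`, seat `planner-b2b-balaban-pv18-g4-0`, 2026-08-18.
-/

open scoped BigOperators
open Finset Function

namespace Literature.MathematicalPhysics.QuantumFieldTheory.Balaban1983to89.T4MixedOscShape

open Literature.MathematicalPhysics.QuantumFieldTheory.Balaban1983to89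
open T4Continuum T4AvgSensitivity T4JointDressing T4JointDressingMany T4HypergraphFormat T4TermFormat

/-! ## §1 Corners of the cube spanned by a family; the triangle bound for the many-body part -/

section Triangle

variable {κ : Type*} [DecidableEq κ]

/-- TRIANGLE BOUND for row K2's many-body part: peeling one member `a ∉ T` (`T4HypergraphFormat.boolDelta_insert`) leaves
`2^{|T|}` first differences in the member `a`, each at most `δ`. [folklore] -/
theorem abs_boolDelta_insert_le (g : Finset κ → ℝ) {a : κ} {T : Finset κ} (ha : a ∉ T) {δ : ℝ}
    (h : ∀ U, U ⊆ T → |g (insert a U) - g U| ≤ δ) : |boolDelta g (insert a T)| ≤ 2 ^ T.card * δ := by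
  rw [boolDelta_insert g ha]
  unfold boolDelta
  rw [← Finset.sum_sub_distrib]
  calc |∑ U ∈ T.powerset, ((-1 : ℝ) ^ (T \ U).card * g (insert a U) - (-1 : ℝ) ^ (T \ U).card * g U)|
      ≤ ∑ U ∈ T.powerset, |(-1 : ℝ) ^ (T \ U).card * g (insert a U) - (-1 : ℝ) ^ (T \ U).card * g U| :=
        Finset.abs_sum_le_sum_abs _ _
    _ ≤ ∑ U ∈ T.powerset, δ := Finset.sum_le_sum fun U hU => by
        rw [← mul_sub, abs_mul, abs_pow, abs_neg, abs_one, one_pow, one_mul]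
        exact h U (Finset.mem_powerset.mp hU)
    _ = 2 ^ T.card * δ := by
        rw [Finset.sum_const, Finset.card_powerset, nsmul_eq_mul]
        push_cast
        ring

end Triangle

section Corner

variable {P : Params} {G : Type*} {k : ℕ} [DecidableEq (PBond P k)] {κ : Type*}

/-- CORNER CONFIGURATION of the cube spanned by a family: the members `a ∈ U` switched to `Y`, everything else kept at `V`
— the tree's fibre update `V←y` on `⋃_{a∈U} Λ a` with `y = Y⌈(⋃_{a∈U} Λ a)`, the configuration inside row K2's
`familyEval`. [folklore] -/
def corner (Λ : κ → Finset (PBond P k)) (V Y : GaugeField P k G) (U : Finset κ) : GaugeField P k G :=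
  Function.updateFinset V (U.biUnion Λ) fun b => Y b.1

/-- Row K2's family evaluation is evaluation at the corner (definitional). [folklore] -/
theorem familyEval_eq_corner (F : GaugeField P k G → ℝ) (Λ : κ → Finset (PBond P k)) (V Y : GaugeField P k G)
    (U : Finset κ) : familyEval (π := fun _ : PBond P k => G) F Λ V Y U = F (corner Λ V Y U) := rfl

/-- Pointwise evaluation of a corner. [folklore] -/
theorem corner_apply (Λ : κ → Finset (PBond P k)) (V Y : GaugeField P k G) (U : Finset κ) (b : PBond P k) :
    corner Λ V Y U b = if b ∈ U.biUnion Λ then Y b else V b := by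
  unfold corner
  simp only [Function.updateFinset]
  split_ifs <;> rfl

/-- The bottom corner is `V`. [folklore] -/
@[simp] theorem corner_empty (Λ : κ → Finset (PBond P k)) (V Y : GaugeField P k G) : corner Λ V Y ∅ = V := by
  funext b
  rw [corner_apply]
  simp

/-- On a bond of a switched-on member the corner reads `Y`. [folklore] -/
theorem corner_of_mem {Λ : κ → Finset (PBond P k)} {V Y : GaugeField P k G} {U : Finset κ} {b : PBond P k} {a : κ}
    (ha : a ∈ U) (hb : b ∈ Λ a) : corner Λ V Y U b = Y b := by
  rw [corner_apply, if_pos (Finset.mem_biUnion.mpr ⟨a, ha, hb⟩)]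

/-- Off the switched-on members the corner reads `V`. [folklore] -/
theorem corner_of_forall_not_mem {Λ : κ → Finset (PBond P k)} {V Y : GaugeField P k G} {U : Finset κ} {b : PBond P k}
    (h : ∀ a ∈ U, b ∉ Λ a) : corner Λ V Y U b = V b := by
  rw [corner_apply, if_neg fun hb => by obtain ⟨a, ha, hba⟩ := Finset.mem_biUnion.mp hb; exact h a ha hba]

variable [DecidableEq κ]

/-- AGREEMENT OFF ONE MEMBER: switching on `a` changes the corner only on `Λ a` (no disjointness needed). [folklore] -/
theorem corner_insert_agree (Λ : κ → Finset (PBond P k)) (V Y : GaugeField P k G) (U : Finset κ) (a : κ) :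
    ∀ b, b ∉ Λ a → corner Λ V Y (insert a U) b = corner Λ V Y U b := by
  intro b hb
  rw [corner_apply, corner_apply]
  simp only [Finset.biUnion_insert, Finset.mem_union, hb, false_or]

/-- An EMPTY member is not felt at all. [folklore] -/
theorem corner_insert_of_empty {Λ : κ → Finset (PBond P k)} {a : κ} (h : Λ a = ∅) (V Y : GaugeField P k G)
    (U : Finset κ) : corner Λ V Y (insert a U) = corner Λ V Y U :=
  funext fun b => corner_insert_agree Λ V Y U a b (by simp [h])

/-- PEELING ONE MEMBER as a fibre update: the corner over `insert a U` is the corner over `U` updated on `Λ a` — the pair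
of configurations NE1a's fibrewise form `LoopOscBound.updateFinset` consumes. [folklore] -/
theorem corner_insert (Λ : κ → Finset (PBond P k)) (V Y : GaugeField P k G) (a : κ) (U : Finset κ) :
    corner Λ V Y (insert a U) = Function.updateFinset (corner Λ V Y U) (Λ a) fun b => Y b.1 := by
  funext b
  by_cases hb : b ∈ Λ a
  · rw [corner_of_mem (Finset.mem_insert_self a U) hb]
    simp only [Function.updateFinset, dif_pos hb]
  · simp only [Function.updateFinset, dif_neg hb]
    exact corner_insert_agree Λ V Y U a b hb

/-- The one-member corner is the fibre update on that member. [folklore] -/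
theorem corner_singleton (Λ : κ → Finset (PBond P k)) (V Y : GaugeField P k G) (a : κ) :
    corner Λ V Y {a} = Function.updateFinset V (Λ a) fun b => Y b.1 := by
  rw [← Finset.insert_empty, corner_insert, corner_empty]

/-- The two-member corner is the iterated fibre update. [folklore] -/
theorem corner_pair (Λ : κ → Finset (PBond P k)) (V Y : GaugeField P k G) (a a' : κ) :
    corner Λ V Y {a, a'}
      = Function.updateFinset (Function.updateFinset V (Λ a') fun b => Y b.1) (Λ a) fun b => Y b.1 := by
  rw [corner_insert, corner_singleton]

end Corner

/-! ## §2 The s-body shape (hypothesis), its locality, its reduction to NE1a, and the s = 1, 2 identifications -/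

section Shape

variable {P : Params} {G : Type*} [GaugeGroup G] [∀ j, DecidableEq (PBond P j)]

/-- The dressed exponent of the cell at level `k` seen `n` levels up: `W(X) = loopAt (avg^n X) (walk x w)`. [folklore] -/
def loopFn (av : ∀ j, Averaging P j G) (k n : ℕ) (x : Site P (k + n)) (w : List (Letter P.d)) :
    GaugeField P k G → ℝ :=
  fun X => loopAt (iterFrom av k n X) (walk x w)

omit [∀ j, DecidableEq (PBond P j)] in
/-- Unfolding `loopFn` (definitional). [folklore] -/
@[simp] theorem loopFn_apply (av : ∀ j, Averaging P j G) (k n : ℕ) (x : Site P (k + n)) (w : List (Letter P.d))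
    (X : GaugeField P k G) : loopFn av k n x w X = loopAt (iterFrom av k n X) (walk x w) := rfl

/-- HYPOTHESIS SHAPE — NE1 (s), s-BODY SENSITIVITY OF ITERATED AVERAGING (record `t4/T4-EST-O3Eii.md` §3.3 (b) "for s ≥ 3
an s-body shape C_s|w|∏_{i∈S}|Λᵢ|·θ_s^{K−k}"): for all levels `k` and step counts `n` in the standing range, every CLOSED
walk `(x, w)` of `T^{(k+n)}`, every NONEMPTY finite family `(Λ a)_{a∈T}` of pairwise DISJOINT sets of level-`k` bonds and
every cube of configurations `corner Λ V Y ·` all of whose corners lie in the domain `dom k`, row K2's `|T|`-body part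
`boolDelta (familyEval W Λ V Y) T` of `W = loopAt · (walk x w) ∘ avg^n` is at most `C |T| · |w| · ∏_{a∈T} |Λ a| · (θ |T|)^n`.
NOT PRINTED (no sensitivity statement for the averagings exists in the series); consumed only as a hypothesis — it is the
free input `δ_T` of `T4HypergraphFormat` §3.  It holds trivially with `(C, θ) = (2^s, 1)` (`loopMixedOscBound_pow_two_one`)
and follows from NE1a with `(2^{s−1}C_W, θ)` (`loopMixedOscBound_of_loopOscBound`), so its content is exactly a rate
`θ s < θ_av`; its `s = 1, 2` cases give back `LoopOscBound` / `LoopPairOscBound` (`loopOscBound_of_loopMixedOscBound`,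
`loopPairOscBound_of_loopMixedOscBound`). [cite: Balaban1985Averaging, (11) p.19] -/
def LoopMixedOscBound (av : ∀ j, Averaging P j G) (dom : ∀ j, Set (GaugeField P j G)) (C θ : ℕ → ℝ) : Prop :=
  ∀ (k n : ℕ), k + n ≤ P.m + P.K → ∀ (x : Site P (k + n)) (w : List (Letter P.d)), walkEnd x w = x →
    ∀ (κ : Type) [DecidableEq κ] (T : Finset κ) (Λ : κ → Finset (PBond P k)), T.Nonempty →
      (∀ a ∈ T, ∀ a' ∈ T, a ≠ a' → Disjoint (Λ a) (Λ a')) →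
      ∀ (V Y : GaugeField P k G), (∀ U, U ⊆ T → corner Λ V Y U ∈ dom k) →
        |boolDelta (familyEval (π := fun _ : PBond P k => G) (loopFn av k n x w) Λ V Y) T|
          ≤ C T.card * (w.length : ℝ) * (∏ a ∈ T, ((Λ a).card : ℝ)) * θ T.card ^ n

/-- The shape is monotone in its constants on `s ≥ 1` (non-negative targets). [folklore] -/
theorem LoopMixedOscBound.mono {av : ∀ j, Averaging P j G} {dom : ∀ j, Set (GaugeField P j G)} {C C' θ θ' : ℕ → ℝ}
    (h : LoopMixedOscBound av dom C θ) (hC : ∀ s, 1 ≤ s → C s ≤ C' s) (hC' : ∀ s, 1 ≤ s → 0 ≤ C' s)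
    (hθ0 : ∀ s, 1 ≤ s → 0 ≤ θ s) (hθ : ∀ s, 1 ≤ s → θ s ≤ θ' s) : LoopMixedOscBound av dom C' θ' := by
  intro k n hn x w hw κ _ T Λ hT hd V Y hdom
  have hs : 1 ≤ T.card := Finset.card_pos.mpr hT
  refine (h k n hn x w hw κ T Λ hT hd V Y hdom).trans ?_
  have hP : (0 : ℝ) ≤ ∏ a ∈ T, ((Λ a).card : ℝ) := Finset.prod_nonneg fun _ _ => Nat.cast_nonneg _
  have h1 : C T.card * (w.length : ℝ) * (∏ a ∈ T, ((Λ a).card : ℝ))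
      ≤ C' T.card * (w.length : ℝ) * (∏ a ∈ T, ((Λ a).card : ℝ)) :=
    mul_le_mul_of_nonneg_right (mul_le_mul_of_nonneg_right (hC _ hs) (Nat.cast_nonneg _)) hP
  exact mul_le_mul h1 (pow_le_pow_left₀ (hθ0 _ hs) (hθ _ hs) n) (pow_nonneg (hθ0 _ hs) n)
    (mul_nonneg (mul_nonneg (hC' _ hs) (Nat.cast_nonneg _)) hP)

/-- The shape is antitone in the domain. [folklore] -/
theorem LoopMixedOscBound.anti {av : ∀ j, Averaging P j G} {dom dom' : ∀ j, Set (GaugeField P j G)} {C θ : ℕ → ℝ}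
    (h : LoopMixedOscBound av dom C θ) (hdom : ∀ j, dom' j ⊆ dom j) : LoopMixedOscBound av dom' C θ :=
  fun k n hn x w hw κ _ T Λ hT hd V Y hd' => h k n hn x w hw κ T Λ hT hd V Y fun U hU => hdom k (hd' U hU)

omit [∀ j, DecidableEq (PBond P j)] in
/-- LOCALITY OF THE s-BODY PART: if the walk AVOIDS the `n`-step influence set of the sources of ONE member `Λ a`, `a ∈ T`,
the `|T|`-body part of the loop variable of the `n`-fold average vanishes — whatever the other members do.  Hence the
hyperedge weights of row K2's format live only on families all of whose members influence the loop (tree axiom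
`Setup.Averaging.local_dep` through `loopAt_iterFrom_eq_of_avoids`; K2's abstract twin is
`boolDelta_familyEval_eq_zero`). [folklore] -/
theorem boolDelta_loop_eq_zero_of_avoids (av : ∀ j, Averaging P j G) {k : ℕ} [DecidableEq (PBond P k)] (n : ℕ)
    (hn : k + n ≤ P.m + P.K) (γ : List (LStep P (k + n))) {κ : Type*} [DecidableEq κ] {T : Finset κ}
    (Λ : κ → Finset (PBond P k)) (V Y : GaugeField P k G) {a : κ} (ha : a ∈ T) (S : Set (Site P k))
    (hS : ∀ b ∈ Λ a, b.src ∈ S) (hγ : ∀ s ∈ γ, s.bond.src ∉ infl S n) :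
    boolDelta (familyEval (π := fun _ : PBond P k => G) (fun X => loopAt (iterFrom av k n X) γ) Λ V Y) T = 0 :=
  boolDelta_eq_zero_of_forall_insert_eq _ ha fun U _ => by
    simp only [familyEval_eq_corner]
    exact loopAt_iterFrom_eq_of_avoids av
      (fun b hb => corner_insert_agree Λ V Y U a b fun hbΛ => hb (hS b hbΛ)) n hn γ hγ

/-- REDUCTION TO NE1a (no gain in the rate): the first-order shape `LoopOscBound av dom C_W θ` implies the s-body shape with
constants `(2^{s−1}·C_W, θ)` — `2^{s−1}` first differences in one member (`corner_insert` + `LoopOscBound.updateFinset`),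
the other members' sizes being `≥ 1` or the s-body part vanishing.  Generalises
`T4JointDressing.loopPairOscBound_of_loopOscBound` (`s = 2`: `2C_W`).  So an s-body input carries information only through
`θ s < θ`. [folklore] -/
theorem loopMixedOscBound_of_loopOscBound {av : ∀ j, Averaging P j G} {dom : ∀ j, Set (GaugeField P j G)} {C_W θ : ℝ}
    (h : LoopOscBound av dom C_W θ) (hC : 0 ≤ C_W) (hθ : 0 ≤ θ) :
    LoopMixedOscBound av dom (fun s => 2 ^ (s - 1) * C_W) (fun _ => θ) := by
  intro k n hn x w hw κ _ T Λ hT _ V Y hdom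
  dsimp only
  set g : Finset κ → ℝ := familyEval (π := fun _ : PBond P k => G) (loopFn av k n x w) Λ V Y with hg
  have hP : (0 : ℝ) ≤ ∏ a ∈ T, ((Λ a).card : ℝ) := Finset.prod_nonneg fun _ _ => Nat.cast_nonneg _
  have hrhs : (0 : ℝ) ≤ 2 ^ (T.card - 1) * C_W * (w.length : ℝ) * (∏ a ∈ T, ((Λ a).card : ℝ)) * θ ^ n :=
    mul_nonneg (mul_nonneg (mul_nonneg (mul_nonneg (pow_nonneg (by norm_num) _) hC) (Nat.cast_nonneg _)) hP)
      (pow_nonneg hθ n)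
  by_cases hempty : ∃ a ∈ T, Λ a = ∅
  · obtain ⟨a, haT, ha0⟩ := hempty
    rw [boolDelta_eq_zero_of_forall_insert_eq g haT fun U _ => by
        simp only [hg, familyEval_eq_corner, corner_insert_of_empty ha0], abs_zero]
    exact hrhs
  have hne : ∀ a' ∈ T, (Λ a').Nonempty := fun a' ha' =>
    Finset.nonempty_iff_ne_empty.mpr fun h0 => hempty ⟨a', ha', h0⟩
  obtain ⟨a, haT⟩ := hT
  have hbound : |boolDelta g (insert a (T.erase a))|
      ≤ 2 ^ (T.erase a).card * (C_W * (w.length : ℝ) * ((Λ a).card : ℝ) * θ ^ n) := by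
    refine abs_boolDelta_insert_le g (T.notMem_erase a) fun U hU => ?_
    have hUT : U ⊆ T := hU.trans (T.erase_subset a)
    have h2 : corner Λ V Y U ∈ dom k := hdom _ hUT
    have h1 : (Function.updateFinset (corner Λ V Y U) (Λ a) fun b => Y b.1) ∈ dom k := by
      rw [← corner_insert]
      exact hdom _ (Finset.insert_subset haT hUT)
    have key := h.updateFinset n hn x w hw (Λ a) (corner Λ V Y U) (fun b => Y b.1) h2 h1
    rw [abs_sub_comm]
    simpa only [hg, familyEval_eq_corner, corner_insert, loopFn_apply] using key
  rw [Finset.insert_erase haT, Finset.card_erase_of_mem haT] at hbound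
  refine hbound.trans ?_
  have hone : (1 : ℝ) ≤ ∏ a' ∈ T.erase a, ((Λ a').card : ℝ) := by
    calc (1 : ℝ) = ∏ _a' ∈ T.erase a, (1 : ℝ) := Finset.prod_const_one.symm
      _ ≤ ∏ a' ∈ T.erase a, ((Λ a').card : ℝ) :=
        Finset.prod_le_prod (fun _ _ => zero_le_one) fun a' ha' => by
          exact_mod_cast Finset.one_le_card.mpr (hne a' (Finset.mem_of_mem_erase ha'))
  have hprod : ((Λ a).card : ℝ) ≤ ∏ a' ∈ T, ((Λ a').card : ℝ) := by
    rw [← Finset.mul_prod_erase T (fun a' => ((Λ a').card : ℝ)) haT]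
    exact le_mul_of_one_le_right (Nat.cast_nonneg _) hone
  calc 2 ^ (T.card - 1) * (C_W * (w.length : ℝ) * ((Λ a).card : ℝ) * θ ^ n)
      = 2 ^ (T.card - 1) * C_W * (w.length : ℝ) * ((Λ a).card : ℝ) * θ ^ n := by ring
    _ ≤ 2 ^ (T.card - 1) * C_W * (w.length : ℝ) * (∏ a' ∈ T, ((Λ a').card : ℝ)) * θ ^ n :=
      mul_le_mul_of_nonneg_right
        (mul_le_mul_of_nonneg_left hprod
          (mul_nonneg (mul_nonneg (pow_nonneg (by norm_num) _) hC) (Nat.cast_nonneg _)))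
        (pow_nonneg hθ n)

/-- TRIVIAL INSTANCE `(C, θ) = (2^s, 1)`: the shape's content is exactly `θ s < 1`. [folklore] -/
theorem loopMixedOscBound_pow_two_one [MeasurableSpace G] [RegularGaugeGroup G] (av : ∀ j, Averaging P j G)
    (dom : ∀ j, Set (GaugeField P j G)) : LoopMixedOscBound av dom (fun s => 2 ^ s) (fun _ => 1) := by
  refine (loopMixedOscBound_of_loopOscBound (loopOscBound_two_one av dom) (by norm_num) zero_le_one).mono
    ?_ (fun s _ => by positivity) (fun _ _ => zero_le_one) (fun _ _ => le_rfl)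
  intro s hs
  obtain ⟨t, rfl⟩ := Nat.exists_eq_add_of_le' hs
  simp [pow_succ]

/-- IDENTIFICATION, s = 1: the one-member case of the shape IS NE1a `LoopOscBound av dom (C 1) (θ 1)` (fibrewise form,
`T4AvgSensitivity.loopOscBound_of_updateFinset`). [folklore] -/
theorem loopOscBound_of_loopMixedOscBound {av : ∀ j, Averaging P j G} {dom : ∀ j, Set (GaugeField P j G)} {C θ : ℕ → ℝ}
    (h : LoopMixedOscBound av dom C θ) : LoopOscBound av dom (C 1) (θ 1) := by
  refine loopOscBound_of_updateFinset fun k n hn x w hw Λ V y hV hV' => ?_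
  set Y : GaugeField P k G := Function.updateFinset V Λ y with hY
  have e1 : corner (fun _ : Unit => Λ) V Y {()} = Y := by
    funext b
    by_cases hb : b ∈ Λ
    · exact corner_of_mem (Finset.mem_singleton_self ()) hb
    · rw [corner_of_forall_not_mem fun _ _ => hb, hY]
      simp only [Function.updateFinset, dif_neg hb]
  have hdom : ∀ U, U ⊆ ({()} : Finset Unit) → corner (fun _ : Unit => Λ) V Y U ∈ dom k := by
    intro U hU
    rcases Finset.subset_singleton_iff.mp hU with rfl | rfl
    · rwa [corner_empty]
    · rwa [e1]
  have key := h k n hn x w hw Unit {()} (fun _ => Λ) ⟨(), Finset.mem_singleton_self _⟩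
    (fun a _ a' _ hne => absurd (Subsingleton.elim a a') hne) V Y hdom
  simp only [boolDelta_singleton, familyEval_eq_corner, e1, corner_empty, loopFn_apply, Finset.card_singleton,
    Finset.prod_singleton] at key
  rwa [abs_sub_comm] at key

/-- The two-member family `true ↦ Λ`, `false ↦ Λ′`. [folklore] -/
def pairFam {k : ℕ} (Λ Λ' : Finset (PBond P k)) : Bool → Finset (PBond P k) := fun i => cond i Λ Λ'

omit [GaugeGroup G] [∀ j, DecidableEq (PBond P j)] in
/-- The first member of `pairFam` (definitional). [folklore] -/
@[simp] theorem pairFam_true {k : ℕ} (Λ Λ' : Finset (PBond P k)) : pairFam Λ Λ' true = Λ := rfl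

omit [GaugeGroup G] [∀ j, DecidableEq (PBond P j)] in
/-- The second member of `pairFam` (definitional). [folklore] -/
@[simp] theorem pairFam_false {k : ℕ} (Λ Λ' : Finset (PBond P k)) : pairFam Λ Λ' false = Λ' := rfl

/-- IDENTIFICATION, s = 2: the two-member case of the shape IS NE1 (ii) `LoopPairOscBound av dom (C 2) (θ 2)` (rectangle
form: with disjoint members every rectangle `V, V₁, V₂, V₁₂` is the cube spanned by `(V, V₁₂)`; K2's
`boolDelta_familyEval_pair` evaluates the two-body part). [folklore] -/
theorem loopPairOscBound_of_loopMixedOscBound {av : ∀ j, Averaging P j G} {dom : ∀ j, Set (GaugeField P j G)}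
    {C θ : ℕ → ℝ} (h : LoopMixedOscBound av dom C θ) : LoopPairOscBound av dom (C 2) (θ 2) := by
  intro k n hn x w hw Λ Λ' hd V V₁ V₂ V₁₂ hV hV₁ hV₂ hV₁₂ h₁ h₂ h₁₂ h₂₁
  have e1 : (Function.updateFinset V (pairFam Λ Λ' true) fun b => V₁₂ b.1) = V₁ := by
    funext b
    by_cases hb : b ∈ Λ
    · simp only [pairFam_true, Function.updateFinset, dif_pos hb]
      exact h₁₂ b (Finset.disjoint_left.mp hd hb)
    · simp only [pairFam_true, Function.updateFinset, dif_neg hb]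
      exact (h₁ b hb).symm
  have e2 : (Function.updateFinset V (pairFam Λ Λ' false) fun b => V₁₂ b.1) = V₂ := by
    funext b
    by_cases hb : b ∈ Λ'
    · simp only [pairFam_false, Function.updateFinset, dif_pos hb]
      exact h₂₁ b (Finset.disjoint_right.mp hd hb)
    · simp only [pairFam_false, Function.updateFinset, dif_neg hb]
      exact (h₂ b hb).symm
  have e12 : (Function.updateFinset V₂ (pairFam Λ Λ' true) fun b => V₁₂ b.1) = V₁₂ := by
    funext b
    by_cases hb : b ∈ Λ
    · simp only [pairFam_true, Function.updateFinset, dif_pos hb]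
    · simp only [pairFam_true, Function.updateFinset, dif_neg hb]
      exact (h₂₁ b hb).symm
  have hU4 : ∀ U : Finset Bool, U = ∅ ∨ U = {true} ∨ U = {false} ∨ U = {true, false} := by
    intro U
    by_cases ht : true ∈ U <;> by_cases hf : false ∈ U
    · right; right; right; ext i; cases i <;> simp [ht, hf]
    · right; left; ext i; cases i <;> simp [ht, hf]
    · right; right; left; ext i; cases i <;> simp [ht, hf]
    · left; ext i; cases i <;> simp [ht, hf]
  have hdom : ∀ U, U ⊆ ({true, false} : Finset Bool) → corner (pairFam Λ Λ') V V₁₂ U ∈ dom k := by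
    intro U _
    rcases hU4 U with rfl | rfl | rfl | rfl
    · rwa [corner_empty]
    · rwa [corner_singleton, e1]
    · rwa [corner_singleton, e2]
    · rwa [corner_pair, e2, e12]
  have hdisj : ∀ a ∈ ({true, false} : Finset Bool), ∀ a' ∈ ({true, false} : Finset Bool), a ≠ a' →
      Disjoint (pairFam Λ Λ' a) (pairFam Λ Λ' a') := by
    intro a _ a' _ hne
    cases a <;> cases a'
    · exact absurd rfl hne
    · exact hd.symm
    · exact hd
    · exact absurd rfl hne
  have key := h k n hn x w hw Bool {true, false} (pairFam Λ Λ') ⟨true, Finset.mem_insert_self _ _⟩ hdisj V V₁₂ hdom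
  have htf : true ∉ ({false} : Finset Bool) := by decide
  rw [boolDelta_familyEval_pair _ _ _ _ (show true ≠ false by decide), e2, e12, e1] at key
  simp only [loopFn_apply, Finset.card_insert_of_notMem htf, Finset.card_singleton, Finset.prod_insert htf,
    Finset.prod_singleton, Nat.reduceAdd, pairFam_true, pairFam_false] at key
  exact key.trans (le_of_eq (by ring))

/-- Consistency check (an `example`, the statement being `T4JointDressing.loopPairOscBound_of_loopOscBound`'s): NE1a ⇒
(s-body shape) ⇒ (s = 2) gives back the landed constants `(2C_W, θ)`. [folklore] -/
example {av : ∀ j, Averaging P j G} {dom : ∀ j, Set (GaugeField P j G)} {C_W θ : ℝ}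
    (h : LoopOscBound av dom C_W θ) (hC : 0 ≤ C_W) (hθ : 0 ≤ θ) : LoopPairOscBound av dom (2 * C_W) θ := by
  have := loopPairOscBound_of_loopMixedOscBound (loopMixedOscBound_of_loopOscBound h hC hθ)
  simpa using this

end Shape

/-! ## §3 The consumer decision as arithmetic: s-hyperedges at the first-order rate -/

section Decision

/-- The record's PER-LEVEL HYPEREDGE RATIO (`t4/T4-EST-O3Eii.md` §3.4 (ii)): `s − 1` partners ranging over `≍ L⁴` positions
per level each, against the s-body rate `θ₁^s` per level — `L^{4(s−1)}·θ₁^s`; the s-body part of the format is K-uniform at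
the birth step iff its `(K − k)`-th power stays bounded. [folklore] -/
noncomputable def hyperedgeRatio (L θ₁ : ℝ) (s : ℕ) : ℝ := L ^ (4 * (s - 1)) * θ₁ ^ s

/-- At the first-order rate `θ₁ = L⁻³` per level the ratio is `L^{s−4}`. [folklore] -/
theorem hyperedgeRatio_eq_zpow {L : ℝ} (hL : 0 < L) {s : ℕ} (hs : 1 ≤ s) :
    hyperedgeRatio L (L ^ 3)⁻¹ s = L ^ ((s : ℤ) - 4) := by
  unfold hyperedgeRatio
  rw [inv_pow, ← pow_mul, ← zpow_natCast, ← zpow_natCast, ← zpow_neg, ← zpow_add₀ hL.ne']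
  congr 1
  push_cast [Nat.cast_sub hs]
  ring

/-- THE DECISION, bounded side: `L^{4(s−1)}θ₁^s ≤ 1` at `θ₁ = L⁻³` iff `s ≤ 4` (record: "with θ₁ = L^{−3} … hyperedges of
order s ≤ 4 are summable and s ≥ 5 are not"). [folklore] -/
theorem hyperedgeRatio_le_one_iff {L : ℝ} (hL : 1 < L) {s : ℕ} (hs : 1 ≤ s) :
    hyperedgeRatio L (L ^ 3)⁻¹ s ≤ 1 ↔ s ≤ 4 := by
  rw [hyperedgeRatio_eq_zpow (zero_lt_one.trans hL) hs, zpow_le_one_iff_right₀ hL]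
  omega

/-- THE DECISION, divergent side: the ratio exceeds `1` iff `s ≥ 5`. [folklore] -/
theorem one_lt_hyperedgeRatio_iff {L : ℝ} (hL : 1 < L) {s : ℕ} (hs : 1 ≤ s) :
    1 < hyperedgeRatio L (L ^ 3)⁻¹ s ↔ 5 ≤ s := by
  rw [hyperedgeRatio_eq_zpow (zero_lt_one.trans hL) hs, one_lt_zpow_iff_right₀ hL]
  omega

/-- For `s ≤ 4` every power of the ratio is at most `1`: the s-body part is uniform in the number `K − k` of levels.
[folklore] -/
theorem hyperedgeRatio_pow_le_one {L : ℝ} (hL : 1 < L) {s : ℕ} (hs : 1 ≤ s) (h4 : s ≤ 4) (n : ℕ) :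
    hyperedgeRatio L (L ^ 3)⁻¹ s ^ n ≤ 1 := by
  have hL0 : 0 < L := zero_lt_one.trans hL
  refine pow_le_one₀ ?_ ((hyperedgeRatio_le_one_iff hL hs).mpr h4)
  unfold hyperedgeRatio
  positivity

/-- For `s ≥ 5` the powers of the ratio are unbounded: the s-body part is NOT uniform in `K − k` (located consequence
G-pv18g3-1 (c)). [folklore] -/
theorem hyperedgeRatio_pow_unbounded {L : ℝ} (hL : 1 < L) {s : ℕ} (h5 : 5 ≤ s) (B : ℝ) :
    ∃ n : ℕ, B < hyperedgeRatio L (L ^ 3)⁻¹ s ^ n :=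
  pow_unbounded_of_one_lt B ((one_lt_hyperedgeRatio_iff hL (le_trans (by norm_num) h5)).mpr h5)

/-- The pair borderline of the record ("with θ₁ = L^{−2} … only pairs, at equality"): `L⁴·(L⁻²)² = 1`. [folklore] -/
theorem hyperedgeRatio_sq_inv_two {L : ℝ} (hL : L ≠ 0) : hyperedgeRatio L (L ^ 2)⁻¹ 2 = 1 := by
  unfold hyperedgeRatio
  rw [inv_pow, ← pow_mul]
  norm_num
  exact mul_inv_cancel₀ (pow_ne_zero 4 hL)

end Decision

/-! ## §4 (α′): a family is one component for the pair shape; bilinear pair strengths are Mayer-small by one count -/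

section AlphaPrime

variable {P : Params} {G : Type*} [GaugeGroup G]

/-- (α′), SENSITIVITY SIDE: the pair shape evaluated on two FAMILIES of components — i.e. on the unions `⋃_{i∈A} Λ i`,
`⋃_{j∈B} Λ′ j` (disjoint from each other) — is the pair shape of two single components whose sizes are the families' TOTAL
sizes: mixed second difference `≤ C₂·|w|·(Σ_i |Λ i|)·(Σ_j |Λ′ j|)·θ₂ⁿ`.  This is the entry "pair = the family" of the row
text: booked as ONE component per family, nothing about the family's internal structure is needed. [folklore] -/
theorem LoopPairOscBound.biUnion {av : ∀ j, Averaging P j G} {dom : ∀ j, Set (GaugeField P j G)} {C₂ θ₂ : ℝ}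
    (h : LoopPairOscBound av dom C₂ θ₂) (hC : 0 ≤ C₂) (hθ : 0 ≤ θ₂) {k : ℕ} [DecidableEq (PBond P k)] (n : ℕ)
    (hn : k + n ≤ P.m + P.K) (x : Site P (k + n)) (w : List (Letter P.d)) (hw : walkEnd x w = x)
    {ι κ : Type*} (A : Finset ι) (Λ : ι → Finset (PBond P k)) (B : Finset κ) (Λ' : κ → Finset (PBond P k))
    (hd : Disjoint (A.biUnion Λ) (B.biUnion Λ')) (V V₁ V₂ V₁₂ : GaugeField P k G) (hV : V ∈ dom k)
    (hV₁ : V₁ ∈ dom k) (hV₂ : V₂ ∈ dom k) (hV₁₂ : V₁₂ ∈ dom k) (h₁ : ∀ b, b ∉ A.biUnion Λ → V₁ b = V b)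
    (h₂ : ∀ b, b ∉ B.biUnion Λ' → V₂ b = V b) (h₁₂ : ∀ b, b ∉ B.biUnion Λ' → V₁₂ b = V₁ b)
    (h₂₁ : ∀ b, b ∉ A.biUnion Λ → V₁₂ b = V₂ b) :
    |loopAt (iterFrom av k n V₁₂) (walk x w) - loopAt (iterFrom av k n V₁) (walk x w)
      - loopAt (iterFrom av k n V₂) (walk x w) + loopAt (iterFrom av k n V) (walk x w)|
      ≤ C₂ * (w.length : ℝ) * (∑ i ∈ A, ((Λ i).card : ℝ)) * (∑ j ∈ B, ((Λ' j).card : ℝ)) * θ₂ ^ n := by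
  refine (h k n hn x w hw _ _ hd V V₁ V₂ V₁₂ hV hV₁ hV₂ hV₁₂ h₁ h₂ h₁₂ h₂₁).trans ?_
  have hA : ((A.biUnion Λ).card : ℝ) ≤ ∑ i ∈ A, ((Λ i).card : ℝ) := by
    exact_mod_cast Finset.card_biUnion_le
  have hB : ((B.biUnion Λ').card : ℝ) ≤ ∑ j ∈ B, ((Λ' j).card : ℝ) := by
    exact_mod_cast Finset.card_biUnion_le
  have h0 : 0 ≤ C₂ * (w.length : ℝ) := mul_nonneg hC (Nat.cast_nonneg _)
  exact mul_le_mul_of_nonneg_right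
    (mul_le_mul (mul_le_mul_of_nonneg_left hA h0) hB (Nat.cast_nonneg _)
      (mul_nonneg h0 (Finset.sum_nonneg fun _ _ => Nat.cast_nonneg _)))
    (pow_nonneg hθ n)

end AlphaPrime

section Ledger

/-- (α′), LEDGER SIDE — BILINEAR PAIR STRENGTHS ARE MAYER-SMALL BY ONE COUNT: if the pair strengths of the abstract ledger
are bilinear in a per-entry mass, `|pair b b′ k| ≤ c k · m b · m b′` (under (α′): `m b` = the total size `Σ_i|Λ_i|` of the
family booked at `b`, `c k = |t|·C₂·|w|·θ₂^{K−k}`, by `LoopPairOscBound.biUnion` and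
`T4JointDressingMany.abs_defect_biUnion_sub_sum_le`), then `Booking.MayerSmall u ε` follows from ONE weighted alive mass
`Σ_{b′ alive at k} m b′ · u b′ ≤ M` and the scalar condition `c k · m b · M ≤ ε` — the single count the record's §3.4 (ii)
`α_block` performs (partner positions × partner weight).  Ledger algebra; no strength is estimated here. [folklore] -/
theorem Booking.mayerSmall_of_bilinear (B : T4TermFormat.Booking) {m u : B.Birth → ℝ} {c : ℕ → ℝ} {M ε : ℝ}
    (hc : ∀ k, 0 ≤ c k) (hm : ∀ b, 0 ≤ m b) (hu : ∀ b, 0 ≤ u b)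
    (hpair : ∀ k, k ≤ B.K → ∀ b ∈ B.alive k, ∀ b' ∈ B.alive k, |B.pair b b' k| ≤ c k * m b * m b')
    (hmass : ∀ k, k ≤ B.K → ∑ b' ∈ B.alive k, m b' * u b' ≤ M)
    (hε : ∀ k, k ≤ B.K → ∀ b ∈ B.alive k, c k * m b * M ≤ ε) : B.MayerSmall u ε := by
  intro k hk b hb
  calc ∑ b' ∈ B.alive k, |B.pair b b' k| * u b'
      ≤ ∑ b' ∈ B.alive k, c k * m b * (m b' * u b') :=
        Finset.sum_le_sum fun b' hb' => by
          rw [← mul_assoc]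
          exact mul_le_mul_of_nonneg_right (hpair k hk b hb b' hb') (hu b')
    _ = c k * m b * ∑ b' ∈ B.alive k, m b' * u b' := by rw [Finset.mul_sum]
    _ ≤ c k * m b * M := mul_le_mul_of_nonneg_left (hmass k hk) (mul_nonneg (hc k) (hm b))
    _ ≤ ε := hε k hk b hb

end Ledger

/-! ## §5 Non-vacuity -/

section NonVacuity

/-- The decision is not vacuous: at `L = 2`, `s = 5` the ratio is `2`, at `s = 4` it is `1`. [folklore] -/
example : hyperedgeRatio 2 (2 ^ 3)⁻¹ 5 = 2 ∧ hyperedgeRatio 2 (2 ^ 3)⁻¹ 4 = 1 := by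
  constructor <;> norm_num [hyperedgeRatio]

/-- The ledger lemma is not vacuous: a one-birth ledger with `pair ≡ p`, `|p| ≤ 1`, is Mayer-small with `u ≡ 1`, `ε = 1`
(masses `m ≡ 1`, `c ≡ 1`, `M = 1`). [folklore] -/
example (p : ℝ) (hp : |p| ≤ 1) :
    (⟨0, Unit, fun _ => 0, fun _ => 0, fun _ => le_rfl, fun _ => 0, Unit, Finset.univ, Finset.mem_univ, fun _ => 0,
      fun _ => le_rfl, fun _ => (), fun _ => rfl, Unit, Finset.univ, Finset.mem_univ, fun _ => 0, fun _ => le_rfl,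
      fun _ => Finset.univ, fun _ _ _ => le_rfl, fun _ _ => 0, fun _ _ => le_rfl, fun _ _ _ => p⟩ :
      T4TermFormat.Booking).MayerSmall (fun _ => 1) 1 := by
  refine Booking.mayerSmall_of_bilinear _ (m := fun _ => 1) (c := fun _ => 1) (M := 1) (fun _ => zero_le_one)
    (fun _ => zero_le_one) (fun _ => zero_le_one) (fun k _ b _ b' _ => by simpa using hp) (fun k _ => ?_)
    (fun _ _ _ _ => by norm_num)
  simp only [mul_one, Finset.sum_const, nsmul_eq_mul, Nat.cast_le_one]
  unfold T4TermFormat.Booking.alive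
  exact (Finset.card_filter_le _ _).trans (by simp)

end NonVacuity

end Literature.MathematicalPhysics.QuantumFieldTheory.Balaban1983to89.T4MixedOscShape
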